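import Literature.Analysis.FunctionSpaces.PVStrictForms
import Literature.Computability.MetaComplexity.BoundedArithUnivPIND
import HarnessLib

/-!
# Herbrand-saturated models of the true universal theory of `(ℕ, PV)` are models of `S₂¹`

Continuation of `PVStrictForms.lean`; the analogue for `S₂¹` of
`Literature/Computability/MetaComplexity/BoundedArithUnivPIND.lean`.  We prove **Krajíček 1995,
Thm. 7.6.3 (1)** in Avigad's formulation (Avigad 2002, §4, Thm. 4.2-style): every
Herbrand-saturated model `K` of the universal theory `trueUnivPV` satisfies, on its reduct to Buss's
language, the theory `S₂¹ = BASIC + Σᵇ₁-PIND` (`model_S2_one_of_isHerbrandSaturated`).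

The argument (`pind_of_isSigmab_ctx`), for a `Σᵇ₁` formula `θ(p̄, x)` with `θ(p̄, 0)` and
`∀ x (θ(p̄, ⌊x/2⌋) → θ(p̄, x))`, and a target `x₀`:
1. take the strict form `θ(p̄, x) ↔ ∃ w ≤ T(p̄, x) ψ(p̄, x, w)` (`hasSigmaForm_of_isSigmab_one`,
   complete in `K` because `K` is Herbrand saturated);
2. the step `∀ x w (w ≤ T(p̄,⌊x/2⌋) ∧ ψ(p̄,⌊x/2⌋,w) → ∃ w' (w' ≤ T(p̄,x) ∧ ψ(p̄,x,w')))` holds in `K`,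
   so Herbrand saturation gives a Skolem *symbol* `G(c̄, x, w)` for `w'` (`exists_skolem_sym_ctx₂`);
3. iterate `G` along the notation of `x` by limited recursion (`PVFun.recW`, bound
   `b = T(p̄, x₀)`): `H(x) = G(c̄, x, H(⌊x/2⌋))`;
4. induction on the notation of `x₀` is *not* available in `K`, but its failure would be witnessed
   by the counterexample-search symbol `PVFun.cex` — a universal sentence true in `ℕ`, hence in
   `K` — at a point `c ≠ 0` where the invariant holds at `⌊c/2⌋` and fails at `c`, contradicting
   the Skolem property of `G`.  Hence `H(x₀)` witnesses `θ(p̄, x₀)`.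
This is the `PV` form of the witnessing argument (Buss 1986, Ch. 5–6; Krajíček 1995, p. 116,
proof of Thm. 7.6.3: "by induction for the formula `ψ(x, u_x)` available in `PVᵢ`").

## References

* J. Krajíček, *Bounded Arithmetic, Propositional Logic and Complexity Theory*, CUP 1995,
  Thm. 7.6.3 (p. 116).
* J. Avigad, *Saturated models of universal theories*, APAL 118 (2002), §4.
* S. R. Buss, *Bounded Arithmetic*, Bibliopolis 1986, Ch. 5 (Main Theorem), Ch. 6.
-/

namespace Literature.Analysis.FunctionSpaces

open FirstOrder FirstOrder.Language FirstOrder.Language.BoundedFormula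
open Literature.Computability.MetaComplexity Literature.Computability.MetaComplexity.BASICModel
open Literature.ModelTheory.UniversalTheories

variable {K : Type} [Language.boundedArith.Structure K] [Language.pv.Structure K]
  [boundedArithToPV.IsExpansionOn K] [hKB : K ⊨ BASIC]

/-! ## Generic facts: composition, projections, conditional, the `≤`-indicator -/

section Generic

variable {n k : ℕ}

omit [Language.boundedArith.Structure K] [boundedArithToPV.IsExpansionOn K] hKB in
/-- **Fact (composition).** `comp f g (x̄) = f(g₀ x̄, …)` in `K`. [cite: Cook1975, §2] -/
theorem papp_comp (hK : K ⊨ trueUnivPV) (f : PVFun k) (g : Fin k → PVFun n) (xs : Fin n → K) :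
    papp (PVFun.comp f g) xs = papp f fun i => papp (g i) xs := by
  let Ψ : Language.pv.BoundedFormula Empty n :=
    Term.bdEqual (Term.func (PVFun.comp f g) fun i => cv i) (Term.func f fun i => Term.func (g i) fun j => cv j)
  have hΨ : Ψ.IsUniversal := (IsAtomic.equal _ _).isQF.isUniversal
  have hfact := realize_of_nat hK hΨ (fun u => by
    simp only [Ψ, realize_bdEqual, Term.realize, Sum.elim_inr, funMap_pv, PVFun.eval_comp]) xs
  simp only [Ψ, realize_bdEqual, Term.realize, Sum.elim_inr] at hfact
  exact hfact

omit [Language.boundedArith.Structure K] [boundedArithToPV.IsExpansionOn K] hKB in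
/-- **Fact (projections).** `proj i (x̄) = xᵢ` in `K`. [cite: Cook1975, §2] -/
theorem papp_proj (hK : K ⊨ trueUnivPV) (i : Fin n) (xs : Fin n → K) : papp (PVFun.proj i) xs = xs i := by
  have h := papp_termSym hK (Term.var i : Language.pv.Term (Fin n)) xs
  simpa [termSym] using h

/-- **Fact (conditional).** `cond (a, b, c) = b` if `a = 0`, `= c` otherwise, in `K`. [cite: Cook1975, §2] -/
theorem papp_cond (hK : K ⊨ trueUnivPV) (w : Fin 3 → K) :
    (w 0 = 0 → papp PVFun.cond w = w 1) ∧ (w 0 ≠ 0 → papp PVFun.cond w = w 2) := by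
  let cT : Language.pv.Term (Empty ⊕ Fin 3) := Term.func PVFun.cond fun i => cv i
  let Ψ : Language.pv.BoundedFormula Empty 3 :=
    (Term.bdEqual (cv 0) (ιt 0) ⟹ Term.bdEqual cT (cv 1)) ⊓ (∼(Term.bdEqual (cv 0) (ιt 0)) ⟹ Term.bdEqual cT (cv 2))
  have hΨ : Ψ.IsUniversal :=
    (((IsAtomic.equal _ _).isQF.imp (IsAtomic.equal _ _).isQF).inf
      ((IsAtomic.equal _ _).isQF.not.imp (IsAtomic.equal _ _).isQF)).isUniversal
  have hfact := realize_of_nat hK hΨ (fun u => by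
    simp only [Ψ, cT, realize_inf, realize_imp, realize_not, realize_bdEqual, Term.realize, Sum.elim_inr,
      funMap_pv, PVFun.eval_cond, ιt, LHom.realize_onTerm, Literature.Computability.MetaComplexity.realize_zero]
    exact ⟨fun h => by rw [if_pos h], fun h => by rw [if_neg h]⟩) w
  simp only [Ψ, cT, realize_inf, realize_imp, realize_not, realize_bdEqual, Term.realize, Sum.elim_inr,
    realize_ιt, realize_term_zero, mZero_eq] at hfact
  exact hfact

/-- **Fact (`≤`-indicator).** `leInd (a, b) = 1` if `a ≤ b`, `= 0` otherwise, in `K`. [cite: Cook1975, §2] -/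
theorem papp_leInd (hK : K ⊨ trueUnivPV) (w : Fin 2 → K) :
    (w 0 ≤ w 1 → papp PVFun.leInd w = 1) ∧ (w 1 < w 0 → papp PVFun.leInd w = 0) := by
  let lT : Language.pv.Term (Empty ⊕ Fin 2) := Term.func PVFun.leInd fun i => cv i
  let Ψ : Language.pv.BoundedFormula Empty 2 :=
    (Term.le (cv 0) (cv 1) ⟹ Term.bdEqual lT pone) ⊓ (∼(Term.le (cv 0) (cv 1)) ⟹ Term.bdEqual lT (ιt 0))
  have hΨ : Ψ.IsUniversal :=
    (((IsAtomic.rel _ _).isQF.imp (IsAtomic.equal _ _).isQF).inf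
      ((IsAtomic.rel _ _).isQF.not.imp (IsAtomic.equal _ _).isQF)).isUniversal
  have hfact := realize_of_nat hK hΨ (fun u => by
    simp only [Ψ, lT, realize_inf, realize_imp, realize_not, realize_bdEqual, Term.realize_le, Term.realize,
      Sum.elim_inr, funMap_pv, PVFun.eval_leInd, ιt, pone, LHom.realize_onTerm,
      Literature.Computability.MetaComplexity.realize_zero, realize_natConst]
    exact ⟨fun h => by rw [if_pos h], fun h => by rw [if_neg h]⟩) w
  simp only [Ψ, lT, realize_inf, realize_imp, realize_not, realize_bdEqual, realize_pvle, Term.realize,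
    Sum.elim_inr, realize_ιt, realize_term_zero, mZero_eq, realize_natConst_one, mSucc_eq, zero_add, not_le] at hfact
  exact hfact

/-- `andInd t u (x̄) = 0` if `t x̄ = 0`, `= u x̄` otherwise, in `K`. [folklore] -/
theorem papp_andInd (hK : K ⊨ trueUnivPV) (t u : PVFun n) (xs : Fin n → K) :
    (papp t xs = 0 → papp (PVFun.andInd t u) xs = 0) ∧ (papp t xs ≠ 0 → papp (PVFun.andInd t u) xs = papp u xs) := by
  have e : papp (PVFun.andInd t u) xs = papp PVFun.cond ![papp t xs, 0, papp u xs] := by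
    rw [PVFun.andInd, PVFun.ap₃, papp_comp hK]
    congr 1
    funext i
    fin_cases i
    · rfl
    · show papp (PVFun.zero' : PVFun n) xs = 0
      rw [PVFun.zero', papp_comp hK, papp_zero, mZero_eq]
    · rfl
  rw [e]
  have h := papp_cond hK ![papp t xs, 0, papp u xs]
  simpa using h

omit [Language.boundedArith.Structure K] [boundedArithToPV.IsExpansionOn K] hKB in
/-- `ap₂ f t u (x̄) = f (t x̄, u x̄)` in `K`. [folklore] -/
theorem papp_ap₂ (hK : K ⊨ trueUnivPV) (f : PVFun 2) (t u : PVFun n) (xs : Fin n → K) :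
    papp (PVFun.ap₂ f t u) xs = papp f ![papp t xs, papp u xs] := by
  rw [PVFun.ap₂, papp_comp hK]
  congr 1
  funext i
  fin_cases i <;> rfl

end Generic

/-! ## Facts: limited recursion and counterexample search -/

section RecFacts

variable {p : ℕ}

/-- **Fact (start of the recursion).** `v ≤ T(ȳ, 0) → recW G T (ȳ, v, 0) = v` in `K`.
[cite: Cook1975, §2] -/
theorem recW_zero' (hK : K ⊨ trueUnivPV) (G : PVFun (p + 2)) (T : PVFun (p + 1)) (ys : Fin p → K) {v : K}
    (hv : v ≤ papp T (Fin.snoc ys 0)) : papp (PVFun.recW G T) (Fin.snoc (Fin.snoc ys v) 0) = v := by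
  -- context `(ȳ, v)`
  let TT : Language.pv.Term (Empty ⊕ Fin (p + 1)) :=
    Term.func T (Fin.snoc (fun j : Fin p => cv (Fin.castSucc j)) (ιt 0))
  let HT : Language.pv.Term (Empty ⊕ Fin (p + 1)) :=
    Term.func (PVFun.recW G T) (Fin.snoc (fun j : Fin (p + 1) => cv j) (ιt 0))
  let Ψ : Language.pv.BoundedFormula Empty (p + 1) := Term.le (cv (Fin.last p)) TT ⟹ Term.bdEqual HT (cv (Fin.last p))
  have hΨ : Ψ.IsUniversal := ((IsAtomic.rel _ _).isQF.imp (IsAtomic.equal _ _).isQF).isUniversal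
  have hfact := realize_of_nat hK hΨ (fun xs => by
    obtain ⟨zs, u, rfl⟩ := exists_eq_snoc xs
    simp only [Ψ, TT, HT, realize_imp, realize_bdEqual, Term.realize_le, Term.realize, QSym.realize_snoc_terms,
      Sum.elim_inr, Fin.snoc_castSucc, Fin.snoc_last, funMap_pv, ιt, LHom.realize_onTerm,
      Literature.Computability.MetaComplexity.realize_zero]
    intro h
    exact (PVFun.eval_recW_zero G T zs u).trans (min_eq_left h)) (Fin.snoc ys v)
  simp only [Ψ, TT, HT, realize_imp, realize_bdEqual, realize_pvle, Term.realize, QSym.realize_snoc_terms,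
    Sum.elim_inr, Fin.snoc_castSucc, Fin.snoc_last, realize_ιt, realize_term_zero, mZero_eq] at hfact
  exact hfact hv

/-- **Fact (recursion step).** For `x ≠ 0`, if `G(ȳ, x, H(ȳ, v, ⌊x/2⌋)) ≤ T(ȳ, x)` then
`recW G T (ȳ, v, x) = G(ȳ, x, recW G T (ȳ, v, ⌊x/2⌋))`, in `K`. [cite: Cook1975, §2] -/
theorem recW_step' (hK : K ⊨ trueUnivPV) (G : PVFun (p + 2)) (T : PVFun (p + 1)) (ys : Fin p → K) (v : K)
    {x : K} (hx : x ≠ 0)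
    (hle : papp G (Fin.snoc (Fin.snoc ys x) (papp (PVFun.recW G T) (Fin.snoc (Fin.snoc ys v) (mHalf x)))) ≤
      papp T (Fin.snoc ys x)) :
    papp (PVFun.recW G T) (Fin.snoc (Fin.snoc ys v) x) =
      papp G (Fin.snoc (Fin.snoc ys x) (papp (PVFun.recW G T) (Fin.snoc (Fin.snoc ys v) (mHalf x)))) := by
  -- context `(ȳ, v, x)`
  let pre : Language.pv.Term (Empty ⊕ Fin (p + 2)) :=
    Term.func (PVFun.recW G T) (Fin.snoc (fun j : Fin (p + 1) => cv (Fin.castSucc j))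
      (fn1 PVFun.half (cv (Fin.last (p + 1)))))
  let GT : Language.pv.Term (Empty ⊕ Fin (p + 2)) :=
    Term.func G (Fin.snoc (Fin.snoc (fun j : Fin p => cv (Fin.castSucc (Fin.castSucc j))) (cv (Fin.last (p + 1)))) pre)
  let TT : Language.pv.Term (Empty ⊕ Fin (p + 2)) :=
    Term.func T (Fin.snoc (fun j : Fin p => cv (Fin.castSucc (Fin.castSucc j))) (cv (Fin.last (p + 1))))
  let HT : Language.pv.Term (Empty ⊕ Fin (p + 2)) := Term.func (PVFun.recW G T) fun j => cv j
  let Ψ : Language.pv.BoundedFormula Empty (p + 2) :=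
    ∼(Term.bdEqual (cv (Fin.last (p + 1))) (ιt 0)) ⟹ Term.le GT TT ⟹ Term.bdEqual HT GT
  have hΨ : Ψ.IsUniversal :=
    ((IsAtomic.equal _ _).isQF.not.imp ((IsAtomic.rel _ _).isQF.imp (IsAtomic.equal _ _).isQF)).isUniversal
  have hfact := realize_of_nat hK hΨ (fun xs => by
    obtain ⟨xs', a, rfl⟩ := exists_eq_snoc xs
    obtain ⟨zs, u, rfl⟩ := exists_eq_snoc xs'
    simp only [Ψ, pre, GT, TT, HT, realize_imp, realize_not, realize_bdEqual, Term.realize_le, Term.realize,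
      QSym.realize_snoc_terms, Sum.elim_inr, Fin.snoc_castSucc, Fin.snoc_last, funMap_pv, funMap_vec1,
      PVFun.eval_half, Matrix.cons_val_zero, ιt, LHom.realize_onTerm,
      Literature.Computability.MetaComplexity.realize_zero]
    intro ha h
    have hdec : Nat.bit (Nat.bodd a) (Nat.div2 a) = a := Nat.bit_bodd_div2 a
    have hb : Nat.div2 a = 0 → Nat.bodd a = true := by
      intro h0
      by_contra hb
      apply ha
      rw [← hdec, h0, Bool.eq_false_iff.2 hb]
      rfl
    have key := PVFun.eval_recW_bit G T zs u hb
    rw [hdec, Nat.div2_val] at key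
    exact key.trans (min_eq_left h)) (Fin.snoc (Fin.snoc ys v) x)
  simp only [Ψ, pre, GT, TT, HT, realize_imp, realize_not, realize_bdEqual, realize_pvle, Term.realize,
    QSym.realize_snoc_terms, Sum.elim_inr, Fin.snoc_castSucc, Fin.snoc_last, funMap_vec1, papp_half,
    realize_ιt, realize_term_zero, mZero_eq] at hfact
  exact hfact hx hle

/-- **Fact (counterexample search).** In `K`, writing `C = cex Gd (ȳ, x)`: `C ≤ x`, and if
`Gd(ȳ, 0) ≠ 0` and `Gd(ȳ, x) = 0` then `C ≠ 0`, `Gd(ȳ, C) = 0`, `Gd(ȳ, ⌊C/2⌋) ≠ 0`.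
[cite: Krajicek1995, §5.3] -/
theorem cex_spec' (hK : K ⊨ trueUnivPV) (Gd : PVFun (p + 1)) (ys : Fin p → K) (x : K) :
    papp (PVFun.cex Gd) (Fin.snoc ys x) ≤ x ∧
    (papp Gd (Fin.snoc ys 0) ≠ 0 → papp Gd (Fin.snoc ys x) = 0 →
      papp (PVFun.cex Gd) (Fin.snoc ys x) ≠ 0 ∧
      papp Gd (Fin.snoc ys (papp (PVFun.cex Gd) (Fin.snoc ys x))) = 0 ∧
      papp Gd (Fin.snoc ys (mHalf (papp (PVFun.cex Gd) (Fin.snoc ys x)))) ≠ 0) := by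
  let CT : Language.pv.Term (Empty ⊕ Fin (p + 1)) := Term.func (PVFun.cex Gd) fun j => cv j
  let Gat : Language.pv.Term (Empty ⊕ Fin (p + 1)) → Language.pv.Term (Empty ⊕ Fin (p + 1)) := fun t =>
    Term.func Gd (Fin.snoc (fun j : Fin p => cv (Fin.castSucc j)) t)
  let z : Language.pv.Term (Empty ⊕ Fin (p + 1)) := ιt 0
  let Ψ : Language.pv.BoundedFormula Empty (p + 1) :=
    Term.le CT (cv (Fin.last p)) ⊓
      (∼(Term.bdEqual (Gat z) z) ⟹ Term.bdEqual (Gat (cv (Fin.last p))) z ⟹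
        (∼(Term.bdEqual CT z) ⊓ Term.bdEqual (Gat CT) z ⊓ ∼(Term.bdEqual (Gat (fn1 PVFun.half CT)) z)))
  have hΨ : Ψ.IsUniversal :=
    ((IsAtomic.rel _ _).isQF.inf ((IsAtomic.equal _ _).isQF.not.imp ((IsAtomic.equal _ _).isQF.imp
      (((IsAtomic.equal _ _).isQF.not.inf (IsAtomic.equal _ _).isQF).inf (IsAtomic.equal _ _).isQF.not)))).isUniversal
  have hfact := realize_of_nat hK hΨ (fun xs => by
    obtain ⟨zs, a, rfl⟩ := exists_eq_snoc xs
    simp only [Ψ, CT, Gat, z, realize_inf, realize_imp, realize_not, realize_bdEqual, Term.realize_le,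
      Term.realize, QSym.realize_snoc_terms, Sum.elim_inr, Fin.snoc_castSucc, Fin.snoc_last, funMap_pv,
      funMap_vec1, PVFun.eval_half, Matrix.cons_val_zero, ιt, LHom.realize_onTerm,
      Literature.Computability.MetaComplexity.realize_zero]
    obtain ⟨hle, h1, h2⟩ := PVFun.cex_spec Gd zs a
    refine ⟨hle, fun h0 hx => ?_⟩
    have hC : (PVFun.cex Gd).eval (Fin.snoc zs a) ≠ 0 := fun hC => h2 hC h0 hx
    exact ⟨⟨hC, (h1 hC).1⟩, (h1 hC).2⟩) (Fin.snoc ys x)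
  simp only [Ψ, CT, Gat, z, realize_inf, realize_imp, realize_not, realize_bdEqual, realize_pvle, Term.realize,
    QSym.realize_snoc_terms, Sum.elim_inr, Fin.snoc_castSucc, Fin.snoc_last, funMap_vec1, papp_half,
    realize_ιt, realize_term_zero, mZero_eq] at hfact
  obtain ⟨hle, h⟩ := hfact
  exact ⟨hle, fun h0 hx => let ⟨⟨a, b⟩, c⟩ := h h0 hx; ⟨a, b, c⟩⟩

end RecFacts

/-! ## `Σᵇ₁`-PIND in a Herbrand-saturated model -/

section PIND

variable {m : ℕ}

/-- **`Σᵇ₁`-PIND in a Herbrand-saturated model of `trueUnivPV`** (context-variables form): for a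
`Σᵇ₁` formula `θ(p̄, x)`, if `θ(p̄, 0)` and `∀ x (θ(p̄, ⌊x/2⌋) → θ(p̄, x))` then `∀ x θ(p̄, x)`
(Krajíček 1995, Thm. 7.6.3 (1), for `i = 1`; Avigad 2002, §4). [cite: Krajicek1995, Theorem 7.6.3] -/
theorem pind_of_isSigmab_ctx (hK : K ⊨ trueUnivPV) (hsat : IsHerbrandSaturated Language.pv K)
    {θ : Language.boundedArith.BoundedFormula Empty (m + 1)} (hθ : IsSigmab 1 θ) (pa : Fin m → K)
    (h0 : θ.Realize default (Fin.snoc pa 0))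
    (hstep : ∀ x : K, θ.Realize default (Fin.snoc pa (mHalf x)) → θ.Realize default (Fin.snoc pa x)) :
    ∀ x : K, θ.Realize default (Fin.snoc pa x) := by
  obtain ⟨ψ, T, hψ, hs, hc⟩ := hasSigmaForm_of_isSigmab_one hθ
  -- the invariant `Good x : ∃ w ≤ T(p̄, x), ψ(p̄, x, w)`
  have hs' : ∀ (x w : K), w ≤ T.realize (Sum.elim default (Fin.snoc pa x)) →
      ψ.Realize default (Fin.snoc (Fin.snoc pa x) w) → θ.Realize default (Fin.snoc pa x) :=
    fun x w hw h => hs K hK (Fin.snoc pa x) w ((mLe_iff _ _).2 hw) h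
  have hc' : ∀ x : K, θ.Realize default (Fin.snoc pa x) →
      ∃ w : K, w ≤ T.realize (Sum.elim default (Fin.snoc pa x)) ∧ ψ.Realize default (Fin.snoc (Fin.snoc pa x) w) :=
    fun x h => by
      obtain ⟨w, hw, h⟩ := hc K hK hsat (Fin.snoc pa x) h
      exact ⟨w, (mLe_iff _ _).1 hw, h⟩
  intro x₀
  -- the step formula `Θ(p̄; x, w, w')`
  let halfX : Language.pv.Term (Empty ⊕ Fin (m + 3)) := fn1 PVFun.half (cv (Fin.castSucc (Fin.castSucc (Fin.last m))))
  let pv3 : Fin m → Language.pv.Term (Empty ⊕ Fin (m + 3)) :=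
    fun j => cv (Fin.castSucc (Fin.castSucc (Fin.castSucc j)))
  let Tat : Language.pv.Term (Empty ⊕ Fin (m + 3)) → Language.pv.Term (Empty ⊕ Fin (m + 3)) := fun t =>
    (ιt T).subst (Sum.elim (fun e => Term.var (Sum.inl e)) (Fin.snoc (fun j => pv3 j) t))
  let Θ : Language.pv.BoundedFormula Empty (m + 3) :=
    (Term.le (cv (Fin.castSucc (Fin.last (m + 1)))) (Tat halfX) ⊓
        substCtx ψ (Fin.snoc (Fin.snoc pv3 halfX) (cv (Fin.castSucc (Fin.last (m + 1)))))) ⟹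
      (Term.le (cv (Fin.last (m + 2))) (Tat (cv (Fin.castSucc (Fin.castSucc (Fin.last m))))) ⊓
        substCtx ψ (Fin.snoc (Fin.snoc pv3 (cv (Fin.castSucc (Fin.castSucc (Fin.last m))))) (cv (Fin.last (m + 2)))))
  have hΘ : Θ.IsQF :=
    ((IsAtomic.rel _ _).isQF.inf (isQF_substCtx hψ _)).imp ((IsAtomic.rel _ _).isQF.inf (isQF_substCtx hψ _))
  have hTat : ∀ (t : Language.pv.Term (Empty ⊕ Fin (m + 3))) (x w w' : K),
      (Tat t).realize (Sum.elim default (Fin.snoc (Fin.snoc (Fin.snoc pa x) w) w')) =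
        T.realize (Sum.elim default (Fin.snoc pa (t.realize (Sum.elim default (Fin.snoc (Fin.snoc (Fin.snoc pa x) w) w'))))) := by
    intro t x w w'
    simp only [Tat, Term.realize_subst, realize_ιt]
    congr 1
    funext c; rcases c with c | j
    · exact c.elim
    · simp only [Sum.elim_inr]
      cases j using Fin.lastCases with
      | last => simp
      | cast j => simp [pv3]
  have hctx : ∀ (t u : Language.pv.Term (Empty ⊕ Fin (m + 3))) (x w w' : K),
      (fun i => Term.realize (Sum.elim default (Fin.snoc (Fin.snoc (Fin.snoc pa x) w) w'))
        ((Fin.snoc (Fin.snoc pv3 t) u : Fin (m + 2) → Language.pv.Term (Empty ⊕ Fin (m + 3))) i)) =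
        Fin.snoc (Fin.snoc pa (t.realize (Sum.elim default (Fin.snoc (Fin.snoc (Fin.snoc pa x) w) w'))))
          (u.realize (Sum.elim default (Fin.snoc (Fin.snoc (Fin.snoc pa x) w) w'))) := by
    intro t u x w w'
    funext i
    cases i using Fin.lastCases with
    | last => simp
    | cast i =>
      cases i using Fin.lastCases with
      | last => simp
      | cast i => simp [pv3]
  have hΘsem : ∀ x w w' : K, Θ.Realize default (Fin.snoc (Fin.snoc (Fin.snoc pa x) w) w') ↔
      ((w ≤ T.realize (Sum.elim default (Fin.snoc pa (mHalf x))) ∧ ψ.Realize default (Fin.snoc (Fin.snoc pa (mHalf x)) w)) →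
        (w' ≤ T.realize (Sum.elim default (Fin.snoc pa x)) ∧ ψ.Realize default (Fin.snoc (Fin.snoc pa x) w'))) := by
    intro x w w'
    simp only [Θ, realize_imp, realize_inf, realize_pvle, realize_substCtx, hTat, hctx, Term.realize, Sum.elim_inr,
      Fin.snoc_castSucc, Fin.snoc_last, halfX, funMap_vec1, papp_half]
  -- Skolem symbol for the step
  obtain ⟨q, c, G, hG⟩ := exists_skolem_sym_ctx₂ hK hsat hΘ pa fun x w => by
    by_cases hyp : w ≤ T.realize (Sum.elim default (Fin.snoc pa (mHalf x))) ∧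
        ψ.Realize default (Fin.snoc (Fin.snoc pa (mHalf x)) w)
    · obtain ⟨w', hw', hψ'⟩ := hc' x (hstep x (hs' _ _ hyp.1 hyp.2))
      exact ⟨w', (hΘsem x w w').2 fun _ => ⟨hw', hψ'⟩⟩
    · exact ⟨0, (hΘsem x w 0).2 fun h => absurd h hyp⟩
  have hG' : ∀ x w : K, w ≤ T.realize (Sum.elim default (Fin.snoc pa (mHalf x))) →
      ψ.Realize default (Fin.snoc (Fin.snoc pa (mHalf x)) w) →
      papp G (Fin.snoc (Fin.snoc c x) w) ≤ T.realize (Sum.elim default (Fin.snoc pa x)) ∧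
        ψ.Realize default (Fin.snoc (Fin.snoc pa x) (papp G (Fin.snoc (Fin.snoc c x) w))) :=
    fun x w hw h => (hΘsem x w _).1 (hG x w) ⟨hw, h⟩
  -- initial witness and the bound
  obtain ⟨w₀, hw₀, hψ₀⟩ := hc' 0 h0
  set b : K := T.realize (Sum.elim default (Fin.snoc pa x₀)) with hb
  -- the parameter block `e = (p̄, c̄, b)` and the symbols
  let N : ℕ := m + (q + 1)
  let e : Fin N → K := Fin.append pa (Fin.snoc c b)
  have heP : ∀ j : Fin m, e (Fin.castAdd (q + 1) j) = pa j := fun j => by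
    simp only [e, Fin.append_left]
  have heC : ∀ j : Fin q, e (Fin.natAdd m (Fin.castSucc j)) = c j := fun j => by
    simp only [e, Fin.append_right, Fin.snoc_castSucc]
  have heB : e (Fin.natAdd m (Fin.last q)) = b := by
    simp only [e, Fin.append_right, Fin.snoc_last]
  let G' : PVFun (N + 2) := PVFun.comp G (Fin.snoc (Fin.snoc
    (fun j : Fin q => PVFun.proj (Fin.castSucc (Fin.castSucc (Fin.natAdd m (Fin.castSucc j)))))
    (PVFun.proj (Fin.castSucc (Fin.last N)))) (PVFun.proj (Fin.last (N + 1))))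
  let T' : PVFun (N + 1) := PVFun.proj (Fin.castSucc (Fin.natAdd m (Fin.last q)))
  let H : PVFun (N + 2) := PVFun.recW G' T'
  let Tsym : PVFun (N + 1) := termSym ((ιt T).relabel
    (Sum.elim Empty.elim (Fin.snoc (fun j : Fin m => Fin.castSucc (Fin.castAdd (q + 1) j)) (Fin.last N))))
  let ψsym : PVFun (N + 2) := PVFun.comp (charSym ψ) (Fin.snoc (Fin.snoc
    (fun j : Fin m => PVFun.proj (Fin.castSucc (Fin.castSucc (Fin.castAdd (q + 1) j))))
    (PVFun.proj (Fin.castSucc (Fin.last N)))) (PVFun.proj (Fin.last (N + 1))))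
  let TsymVX : PVFun (N + 2) := PVFun.comp Tsym (Fin.snoc (fun j : Fin N => PVFun.proj (Fin.castSucc (Fin.castSucc j)))
    (PVFun.proj (Fin.last (N + 1))))
  let ψH : PVFun (N + 2) := PVFun.comp ψsym (Fin.snoc (Fin.snoc
    (fun j : Fin N => PVFun.proj (Fin.castSucc (Fin.castSucc j))) (PVFun.proj (Fin.last (N + 1)))) H)
  let Gd : PVFun (N + 2) := PVFun.andInd (PVFun.ap₂ PVFun.leInd H TsymVX) ψH
  -- evaluation of the symbols in `K`
  have hG'v : ∀ x w : K, papp G' (Fin.snoc (Fin.snoc e x) w) = papp G (Fin.snoc (Fin.snoc c x) w) := by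
    intro x w
    rw [papp_comp hK]
    congr 1
    funext i
    cases i using Fin.lastCases with
    | last => simp only [papp_proj hK, Fin.snoc_last]
    | cast i =>
      cases i using Fin.lastCases with
      | last => simp only [papp_proj hK, Fin.snoc_castSucc, Fin.snoc_last]
      | cast i => simp only [papp_proj hK, Fin.snoc_castSucc, heC]
  have hT'v : ∀ x : K, papp T' (Fin.snoc e x) = b := by
    intro x
    rw [papp_proj hK, Fin.snoc_castSucc, heB]
  have hTsymv : ∀ x : K, papp Tsym (Fin.snoc e x) = T.realize (Sum.elim default (Fin.snoc pa x)) := by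
    intro x
    rw [papp_termSym hK, Term.realize_relabel, realize_ιt]
    congr 1
    funext a; rcases a with a | j
    · exact a.elim
    · simp only [Function.comp_apply, Sum.elim_inr]
      cases j using Fin.lastCases with
      | last => simp
      | cast j => simp [heP]
  have hψsymv : ∀ x w : K, papp ψsym (Fin.snoc (Fin.snoc e x) w) = papp (charSym ψ) (Fin.snoc (Fin.snoc pa x) w) := by
    intro x w
    rw [papp_comp hK]
    congr 1
    funext i
    cases i using Fin.lastCases with
    | last => simp [papp_proj hK]
    | cast i =>
      cases i using Fin.lastCases with
      | last => simp [papp_proj hK]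
      | cast i => simp [papp_proj hK, heP]
  have hTsymVXv : ∀ v x : K, papp TsymVX (Fin.snoc (Fin.snoc e v) x) = T.realize (Sum.elim default (Fin.snoc pa x)) := by
    intro v x
    rw [papp_comp hK, ← hTsymv x]
    congr 1
    funext i
    cases i using Fin.lastCases with
    | last => simp [papp_proj hK]
    | cast i => simp [papp_proj hK]
  have hψHv : ∀ v x : K, papp ψH (Fin.snoc (Fin.snoc e v) x) =
      papp (charSym ψ) (Fin.snoc (Fin.snoc pa x) (papp H (Fin.snoc (Fin.snoc e v) x))) := by
    intro v x
    rw [papp_comp hK, ← hψsymv]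
    congr 1
    funext i
    cases i using Fin.lastCases with
    | last => simp
    | cast i =>
      cases i using Fin.lastCases with
      | last => simp [papp_proj hK]
      | cast i => simp [papp_proj hK]
  -- the meaning of `Gd ≠ 0`: the invariant holds at `x` with witness `H(x)`
  have h01χ : ∀ x w : K, papp (charSym ψ) (Fin.snoc (Fin.snoc pa x) w) = 0 ∨
      papp (charSym ψ) (Fin.snoc (Fin.snoc pa x) w) = 1 := fun x w => (papp_charSym hK hψ _).2
  have hGd_iff : ∀ v x : K, papp Gd (Fin.snoc (Fin.snoc e v) x) ≠ 0 ↔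
      (papp H (Fin.snoc (Fin.snoc e v) x) ≤ T.realize (Sum.elim default (Fin.snoc pa x)) ∧
        ψ.Realize default (Fin.snoc (Fin.snoc pa x) (papp H (Fin.snoc (Fin.snoc e v) x)))) := by
    intro v x
    have h10 : (1 : K) ≠ 0 := one_ne_zero
    obtain ⟨ha0, ha1⟩ := papp_andInd hK (PVFun.ap₂ PVFun.leInd H TsymVX) ψH (Fin.snoc (Fin.snoc e v) x)
    have hle := papp_leInd hK ![papp H (Fin.snoc (Fin.snoc e v) x), T.realize (Sum.elim default (Fin.snoc pa x))]
    simp only [Matrix.cons_val_zero, Matrix.cons_val_one] at hle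
    rw [papp_ap₂ hK, hTsymVXv] at ha0 ha1
    rw [← (papp_charSym hK hψ _).1, ← hψHv]
    constructor
    · intro hne
      by_cases hcmp : papp H (Fin.snoc (Fin.snoc e v) x) ≤ T.realize (Sum.elim default (Fin.snoc pa x))
      · refine ⟨hcmp, ?_⟩
        have h1 := hle.1 hcmp
        rw [ha1 (by rw [h1]; exact h10)] at hne
        rw [hψHv] at hne ⊢
        exact ((h01χ _ _).resolve_left hne)
      · exact absurd (ha0 (hle.2 (not_le.1 hcmp))) hne
    · rintro ⟨hcmp, hχ⟩
      have h1 := hle.1 hcmp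
      rw [ha1 (by rw [h1]; exact h10), hχ]
      exact h10
  -- the invariant at `0` and its failure would produce a counterexample point
  have hstart : papp H (Fin.snoc (Fin.snoc e w₀) 0) = w₀ := by
    refine recW_zero' hK G' T' e ?_
    rw [hT'v, hb]
    refine le_trans hw₀ (realize_mono hK T fun a => ?_)
    rcases a with a | j
    · exact a.elim
    · cases j using Fin.lastCases with
      | last => simpa using (bot_le : (0 : K) ≤ x₀)
      | cast j => simp
  have hGd0 : papp Gd (Fin.snoc (Fin.snoc e w₀) 0) ≠ 0 := by
    rw [hGd_iff, hstart]
    exact ⟨hw₀, hψ₀⟩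
  have hGdx : papp Gd (Fin.snoc (Fin.snoc e w₀) x₀) ≠ 0 := by
    intro hx
    obtain ⟨hCle, hC⟩ := cex_spec' hK Gd (Fin.snoc e w₀) x₀
    obtain ⟨hC0, hGdC, hGdhalf⟩ := hC hGd0 hx
    set C : K := papp (PVFun.cex Gd) (Fin.snoc (Fin.snoc e w₀) x₀) with hCdef
    -- the invariant at `⌊C/2⌋`
    obtain ⟨hHle, hHψ⟩ := (hGd_iff w₀ (mHalf C)).1 hGdhalf
    -- the Skolem step at `C`
    obtain ⟨hGle, hGψ⟩ := hG' C _ hHle hHψ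
    -- the recursion step at `C ≠ 0`
    have hmono : T.realize (Sum.elim default (Fin.snoc pa C)) ≤ b := by
      rw [hb]
      refine realize_mono hK T fun a => ?_
      rcases a with a | j
      · exact a.elim
      · cases j using Fin.lastCases with
        | last => simpa using hCle
        | cast j => simp
    have hrec := recW_step' hK G' T' e w₀ hC0 (by
      rw [hG'v, hT'v]; exact le_trans hGle hmono)
    rw [hG'v] at hrec
    -- hence the invariant holds at `C`: contradiction
    refine absurd ((hGd_iff w₀ C).2 ?_) (by rw [hGdC]; exact fun h => h rfl)
    rw [show papp H (Fin.snoc (Fin.snoc e w₀) C) = _ from hrec]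
    exact ⟨hGle, hGψ⟩
  obtain ⟨hle, hψx⟩ := (hGd_iff w₀ x₀).1 hGdx
  exact hs' x₀ _ hle hψx

/-- **`Σᵇ₁`-PIND in a Herbrand-saturated model of `trueUnivPV`**: every `PIND` axiom of a `Σᵇ₁`
formula (with parameters) holds. [cite: Krajicek1995, Theorem 7.6.3] -/
theorem pind_of_isSigmab_one (hK : K ⊨ trueUnivPV) (hsat : IsHerbrandSaturated Language.pv K)
    (φ : Language.boundedArith.Formula (Fin (m + 1))) (hφ : IsSigmab 1 φ) :
    K ⊨ pindAxiom φ := by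
  rw [realize_pindAxiom_iff]
  intro p h0 hstep a
  have hθ : IsSigmab 1 (QSym.toCtx φ) := hφ.relabel _
  have h := pind_of_isSigmab_ctx hK hsat hθ p (by rw [QSym.realize_toCtx, ← mZero_eq]; exact h0)
    (fun x hx => (QSym.realize_toCtx φ _).2 (hstep x ((QSym.realize_toCtx φ _).1 hx))) a
  exact (QSym.realize_toCtx φ _).1 h

end PIND

/-! ## Herbrand-saturated models of `trueUnivPV` are models of `S₂¹` -/

omit [Language.boundedArith.Structure K] [boundedArithToPV.IsExpansionOn K] hKB in
/-- **Every Herbrand-saturated model of `trueUnivPV` is a model of `S₂¹`** on its reduct to Buss's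
language (Krajíček 1995, Thm. 7.6.3 (1): `M' ⊨ S₂¹(PV)`; Avigad 2002, §4).
[cite: Krajicek1995, Theorem 7.6.3] -/
theorem model_S2_one_of_isHerbrandSaturated (hK : K ⊨ trueUnivPV)
    (hsat : IsHerbrandSaturated Language.pv K) :
    @Theory.Model Language.boundedArith K (boundedArithToPV.reduct K) (S2 1) := by
  letI : Language.boundedArith.Structure K := boundedArithToPV.reduct K
  haveI : boundedArithToPV.IsExpansionOn K := LHom.isExpansionOn_reduct _ _
  haveI : K ⊨ BASIC := model_BASIC_of_trueUnivPV hK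
  refine ⟨fun σ hσ => ?_⟩
  rcases hσ with hσ | hσ
  · exact Theory.realize_sentence_of_mem BASIC hσ
  · simp only [PINDScheme, Set.mem_iUnion, Set.mem_image] at hσ
    obtain ⟨m, φ, hφ, rfl⟩ := hσ
    exact pind_of_isSigmab_one hK hsat φ hφ

end Literature.Analysis.FunctionSpaces
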